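import Summits.ResolutionOfSingularities.ResolutionOfSingularities.Theorems.EquisingularLiftEquisingularLiftNatMemberKCLStepSingular
import Summits.ResolutionOfSingularities.ResolutionOfSingularities.Theorems.EquisingularLiftEquisingularLiftNatInvStepSingular
import HarnessLib

/-!
# [OURS · L1 W4.5(b) · EL♮(3)] The (step, flag raised) clause of the inner driver at `INV := TCPlus.InvKCL` (LOCALIZED shadow trace (vii-loc)):
# `invKCL_step_singular` — twin of res-D-pv-029's `invKC_step_singular` (…NatInvKCStepSingular p566286)

res-L1-w45b-stub-4 g8, object (R-b) of res-D-pv-029's retarget list (STATUS 2026-08-27T20:58:53Z). OURS; NOT a statement of any manuscript;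
AI-written, weaker than expert review. No `sorry`; standard axioms. DEF-FREE. `--supports stmt-ResolutionOfSingularities-20148 --as helper`.

WHAT. `invKCL_step_singular`: `TCPlus.InvKCL … W G₁ β T Z Kd false` + the NON-REGULAR point `y` of the running curve, `G₁` regular at `y`,
`υ₁` the blow-up of `y`, and the side fact `IsClosed Z` ⟹ `TCPlus.InvKCL … W G₂ (υ₁ ≫ β) T′ Z′ Kd′ true`. PROOF = `invKC_step_singular` verbatim
(credit: res-D-pv-029 / res-L1-w45b-stub-1's `inv_step_singular`) with `memberKCL_strictTransform_of_centredPoint` (…NatMemberKCLStepSingular).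
-/

set_option linter.dupNamespace false -- mandated namespace `Summit.<Summit>.<Problem>` of this single-conjunct summit
set_option linter.overlappingInstances false -- signatures carry `[IsDomain O] [IsDiscreteValuationRing O]`

noncomputable section

open CategoryTheory CategoryTheory.Limits AlgebraicGeometry TopologicalSpace Topology IsLocalRing
open Literature.AlgebraicGeometry.Resolution
open AlgebraicGeometry.Scheme.IdealSheafData
open Summit.ResolutionOfSingularities.ResolutionOfSingularities.Theses.EquisingularLift.Split

namespace Summit.ResolutionOfSingularities.ResolutionOfSingularities.Cruxes.EquisingularLiftNat.Sections

/-- **(step, flag raised) at `INV := TCPlus.InvKCL`** (localized shadow trace; see the module docstring).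
[cite: GortzWedhorn2020, Prop. 13.91 and (13.19)] [OURS · L1 W4.5b] hypothesis (sing) of the TOWER₄ driver in its `InvKCL` branch, toward
`stub_elnat_coneTowerPointResolution` (stmt-ResolutionOfSingularities-20148 / -20038); NOT a statement of the manuscript. -/
theorem invKCL_step_singular (O : Type) [CommRing O] [IsDomain O] [IsDiscreteValuationRing O]
    (k : Type) [Field k] (θ : O →+* k) (hθ : Function.Surjective θ)
    (P : Scheme.{0}) [IsIntegral P] (q : P ⟶ Spec (.of O)) [IsProper q] [SmoothOfRelativeDimension 3 q]
    (Y : Set P) (hYsp : Y ⊆ q ⁻¹' {closedPoint O}) (hYirr : IsIrreducible Y) (hYcl : IsClosed Y)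
    (hPnoeth : IsLocallyNoetherian P) (hPreg : Scheme.IsRegular P)
    (Ch : ∀ X' : Scheme.{0}, (X' ⟶ P) → Set X' → Prop)
    (hChain : ∀ (X' : Scheme.{0}) (σ : X' ⟶ P) (S : Set X'), Ch X' σ S → Chain P Y X' σ S)
    (hStep : ∀ (X' X'' : Scheme.{0}) (σ' : X' ⟶ P) (S' : Set X') (C : X'.IdealSheafData) (τ : X'' ⟶ X'),
      Ch X' σ' S' → IsBlowup τ C → Scheme.IsRegular C.subscheme → Flat (C.subschemeι ≫ σ' ≫ q) →
      σ' '' (C.support : Set X') ⊆ {x : P | ¬ IsGenericPoint x Y} →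
      (C.support : Set X') ∩ (σ' ≫ q) ⁻¹' {closedPoint O} ⊆ S' →
      Ch X'' (τ ≫ σ') (closure (τ ⁻¹' (S' \ (C.support : Set X')))))
    {F₁ F₂ : Scheme.{0}} (W : Set F₁) (G₁ G₂ : Scheme.{0}) (β : G₁ ⟶ F₂) (T Z Kd : Set G₁)
    (y : ↥((vanishingIdeal (⟨closure Z, isClosed_closure⟩ : Closeds G₁))).subscheme) (υ₁ : G₂ ⟶ G₁)
    (hy : IsClosed ({((vanishingIdeal (⟨closure Z, isClosed_closure⟩ : Closeds G₁)).subschemeι y : G₁)} : Set G₁))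
    (hInv : TCPlus.InvKCL O k θ P q Y Ch W G₁ β T Z Kd false) (hZcl : IsClosed Z)
    (hyT : ((vanishingIdeal (⟨closure Z, isClosed_closure⟩ : Closeds G₁)).subschemeι y : G₁) ∈ T)
    (hysing : ¬ IsRegularLocalRing
      (((vanishingIdeal (⟨closure Z, isClosed_closure⟩ : Closeds G₁))).subscheme.presheaf.stalk y))
    (_hyreg : IsRegularLocalRing
      (G₁.presheaf.stalk ((vanishingIdeal (⟨closure Z, isClosed_closure⟩ : Closeds G₁)).subschemeι y)))
    (hυ₁ : IsBlowup υ₁ (vanishingIdeal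
      ⟨{((vanishingIdeal (⟨closure Z, isClosed_closure⟩ : Closeds G₁)).subschemeι y : G₁)}, hy⟩)) :
    TCPlus.InvKCL O k θ P q Y Ch W G₂ (υ₁ ≫ β)
      (closure (υ₁ ⁻¹' (T \ {((vanishingIdeal (⟨closure Z, isClosed_closure⟩ : Closeds G₁)).subschemeι y : G₁)})))
      (closure (υ₁ ⁻¹' (Z \ {((vanishingIdeal (⟨closure Z, isClosed_closure⟩ : Closeds G₁)).subschemeι y : G₁)})))
      (closure (υ₁ ⁻¹' (Kd \ {((vanishingIdeal (⟨closure Z, isClosed_closure⟩ : Closeds G₁)).subschemeι y : G₁)})))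
      true := by
  classical
  obtain ⟨hGint, -, -, hTZ, -, hflag⟩ := hInv
  haveI := hGint
  have hmem := hflag rfl y hy hysing
  have hxZ : ((vanishingIdeal (⟨closure Z, isClosed_closure⟩ : Closeds G₁)).subschemeι y : G₁) ∈ closure Z := by
    have h : ((vanishingIdeal (⟨closure Z, isClosed_closure⟩ : Closeds G₁)).subschemeι y : G₁) ∈
        Set.range (vanishingIdeal (⟨closure Z, isClosed_closure⟩ : Closeds G₁)).subschemeι := ⟨y, rfl⟩
    rw [Scheme.IdealSheafData.range_subschemeι, Scheme.IdealSheafData.coe_support_vanishingIdeal] at h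
    exact h
  have hTx : ¬ T ⊆ {((vanishingIdeal (⟨closure Z, isClosed_closure⟩ : Closeds G₁)).subschemeι y : G₁)} := fun h =>
    hTZ (h.trans (Set.singleton_subset_iff.mpr hxZ))
  obtain ⟨hG₂int, hT₂irr, hmem₂⟩ := memberKCL_strictTransform_of_centredPoint O k θ hθ P q Y hYsp hYirr hYcl hPnoeth hPreg Ch
    hChain hStep G₁ T Z Kd _ hy hyT hTx hmem hZcl G₂ υ₁ hυ₁
  exact ⟨hG₂int, isClosed_closure, hT₂irr, not_closure_preimage_diff_subset_of_isBlowup_point υ₁ hy hυ₁ hTZ hxZ, hmem₂,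
    fun h => Bool.noConfusion h⟩

end Summit.ResolutionOfSingularities.ResolutionOfSingularities.Cruxes.EquisingularLiftNat.Sections

end
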